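import Summits.CriticalPhenomena.PercolationContinuityZ3.Theorems.PercNearOneGluingNoHeavyQuantEffectiveTargetLemma
import Literature.Probability.Percolation.KozmaNitzanCorridor
import HarnessLib

/-!
# QUANT lane, ERP piece S3b: Kozma–Nitzan's Lemma 12 (halving chain + corridor step) with ADDITIVE losses and BOUNDED route scales

builds on p205010 (kernel theorem, internal audit signed; external expert review pending)

Cell `prim-quant` (post-continuity programme, LANE 1, EXPLICIT-RATE PROGRAMME = LADDER R5), seat `prim-quant-p1` (piece S3b; lead's
re-assignment 2026-08-20T05:40Z); consumers: `prim-quant-p3`'s S4 (`Quant.ksch_theta_slab_pos_of_finiteSizeAt`, hypothesis `hcorr`) and the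
final assembly.  `--supports stmt-CriticalPhenomena-4575 --as helper`.  No definitions, no sorries; standard axioms.

The tree's Lemma 12 (`KozmaNitzan.CData.corridorLemma_of_target`, `Literature/Probability/Percolation/KozmaNitzanCorridor.lean:1573-1637`)
chains `d` halving steps (`halvingChain_of_target` :1253-1275, quarter-face geometries `qfList d` inside the near cube) and one corridor step
(`corridorStep_of_target` :1506-1544, aspect-`88` elongated geometries `elongList d 88` inside `Dcorr`), each an application of the `∀ε ∃δ ∃R`
TARGET PROPERTY; the tolerances therefore nest.  Here every step consumes instead the ADDITIVE, SCALE-INDEXED target lemma in the exact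
conclusion shape of `Quant.targetLemma_additive_core` (seat `prim-quant-p2`, file `…QuantEffectiveTargetLemma.lean`): for all
`(W, Sfin, D, lo, hi, T, o)` with the structural hypotheses and target routes of scales `ℓ ∈ [R, ℓhi]` from a geometry list `H`,
`P_W(o ↔ Icc lo hi) − η ≤ P_W(o ↔ T)`.  Consequently the losses ADD:

* `Quant.halvingStep_additive` — one halving step in the near cube (weighting restricted to `A`): `P(o ↔ B_k) − η_q ≤ P(o ↔ B_{k+1})`;
* `Quant.halvingChain_additive` — `n` steps: `P(o ↔ B_k) − n·η_q ≤ P(o ↔ B_{k+n})` (`k + n ≤ d`);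
* `Quant.corridorStep_additive` — the corridor step (weighting restricted to `U`): `P(o ↔ B_d) − η_e ≤ P(o ↔ cnext + [-2r,2r]^d)`;
* `Quant.corridor_additive` — **Lemma 12, additive**: `P_W(o ↔_A c+[-3r,3r]^d) − (d·η_q + η_e) ≤ P_W(o ↔_U cnext + [-3r,3r]^d)` for `r ≥ 100(d+1)(R+1)`;
* `Quant.corridor_threshold` — the threshold form, binder-for-binder the hypothesis `hcorr` of `Quant.ksch_theta_slab_pos_of_finiteSizeAt`
  (`…QuantSlabPercOfFiniteSize.lean`), valid as soon as `δc + d·η_q + η_e ≤ ε'`;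
* `Quant.corridor_effective` — the losses discharged by `targetLemma_additive_core` (`η_q = η_e = 6δ`): Lemma 12 from the finite-volume hypotheses
  (a) hittability of the quarter-face AND the aspect-88 geometries from `Λ_m` at every scale `ℓ ∈ [ℓmax, 5r]`, (b) orthant-face linking at `(m, M)`,
  (c) the uniqueness zone at `(m, M)` (all at tolerance `δ²`), (d) seeds `(1 − p^{seedBound d M})^k ≤ δ`, (e) radius `R ≥ lemma10Radius`; loss `6(d+1)δ`.
BOUNDED SCALES (why `ℓhi`): the route scales that Lemma 12's targets use are bounded by the cell scale — `ℓ ≤ 5r` for the quarter faces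
(`Qset = v + Λ_ℓ ⊆ nearQ = c + Λ_{5r}`, `Quant.two_mul_scale_le_of_qfList_Qset_subset`) and `ℓ ≤ r` for the aspect-88 boxes (`89ℓ ≤ 24r`,
`Quant.scale_le_of_elongList_Qset_subset_Dcorr`) — so the hypotheses are needed only on `[R, 5r]`; at `p = p_c` the unbounded form would be vacuous.
[cite: KozmaNitzan2024, §4 Lemma 12 (pp. 23–25), Lemma 10 (p. 17)]
-/

noncomputable section

namespace Summit.CriticalPhenomena.PercolationContinuityZ3.Theorems.Quant

open MeasureTheory Literature.Probability.LatticeModels Literature.Probability.Percolation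
  Literature.Probability.Percolation.KozmaNitzan

variable {d : ℕ}

/-! ## Route scales are bounded by the enclosing box -/

/-- For a quarter-face geometry `g ∈ qfList d`, `g.Qset ℓ v = v + Λ_ℓ`; if it lies in a box `Icc lo hi` then `2ℓ ≤ hi i − lo i` in every
coordinate. [cite: KozmaNitzan2024, §4 p. 16 (ℓQ)] -/
theorem two_mul_scale_le_of_qfList_Qset_subset {g : Geom d} (hg : g ∈ qfList d) {ℓ : ℕ} {v lo hi : Site d}
    (h : g.Qset ℓ v ⊆ Finset.Icc lo hi) (i : Fin d) : 2 * (ℓ : ℤ) ≤ hi i - lo i := by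
  obtain ⟨x, -, rfl⟩ := List.mem_map.1 hg
  have hle : v + (ℓ : ℤ) • (qfGeom x.1 x.2).loQ ≤ v + (ℓ : ℤ) • (qfGeom x.1 x.2).hiQ := by
    intro j
    simp only [qfGeom, Pi.add_apply, Pi.smul_apply, smul_eq_mul]
    have : (0 : ℤ) ≤ ℓ := by positivity
    linarith
  have hsub := (Finset.Icc_subset_Icc_iff hle).1 h
  have h1 := hsub.1 i
  have h2 := hsub.2 i
  simp only [qfGeom, Pi.add_apply, Pi.smul_apply, smul_eq_mul] at h1 h2
  linarith

/-- For a quarter-face route inside the near cube `c + Λ_{5r}`, the scale is at most `5r`. [cite: KozmaNitzan2024, §4 p. 24] -/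
theorem scale_le_of_qfList_Qset_subset_nearQ [NeZero d] (S : CData d) {g : Geom d} (hg : g ∈ qfList d) {ℓ : ℕ} {v : Site d}
    (h : g.Qset ℓ v ⊆ S.nearQ) : ℓ ≤ 5 * S.r := by
  have i : Fin d := ⟨0, Nat.pos_of_ne_zero (NeZero.ne d)⟩
  have h2 := two_mul_scale_le_of_qfList_Qset_subset hg h i
  simp only [Pi.add_apply, Pi.sub_apply, Pi.natCast_apply] at h2
  push_cast at h2
  have : (ℓ : ℤ) ≤ 5 * S.r := by linarith
  exact_mod_cast this

/-- For an aspect-`K` elongated geometry `g ∈ elongList d K`, if `g.Qset ℓ v ⊆ Icc lo hi` then `(K+1)·ℓ ≤ hi a − lo a` in the long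
coordinate `a`. [cite: KozmaNitzan2024, §4 Lemma 11 (p. 22)] -/
theorem succ_mul_scale_le_of_elongList_Qset_subset {K : ℕ} {hK : 1 ≤ K} {g : Geom d} (hg : g ∈ elongList d K hK) {ℓ : ℕ}
    {v lo hi : Site d} (h : g.Qset ℓ v ⊆ Finset.Icc lo hi) : ∃ a : Fin d, ((K : ℤ) + 1) * ℓ ≤ hi a - lo a := by
  obtain ⟨x, -, rfl⟩ := List.mem_map.1 hg
  have hℓ0 : (0 : ℤ) ≤ ℓ := by positivity
  have hK0 : (0 : ℤ) ≤ K := by positivity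
  have hle : v + (ℓ : ℤ) • (elongGeom x.1 x.2 K hK).loQ ≤ v + (ℓ : ℤ) • (elongGeom x.1 x.2 K hK).hiQ := by
    intro j
    simp only [elongGeom, sLo, sHi, Pi.add_apply, Pi.smul_apply, smul_eq_mul, Pi.zero_apply]
    by_cases hj : j = x.1
    · rw [if_pos hj, if_pos hj]
      rcases Int.units_eq_one_or x.2 with h1 | h1
      · simp only [h1, Units.val_one, if_true]; nlinarith
      · simp only [h1, Units.val_neg, Units.val_one, show (-1 : ℤ) ≠ 1 by norm_num, if_false]; nlinarith
    · rw [if_neg hj, if_neg hj]; nlinarith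
  have hsub := (Finset.Icc_subset_Icc_iff hle).1 h
  refine ⟨x.1, ?_⟩
  have h1 := hsub.1 x.1
  have h2 := hsub.2 x.1
  simp only [elongGeom, sLo, sHi, Pi.add_apply, Pi.smul_apply, smul_eq_mul, Pi.zero_apply, if_true] at h1 h2
  rcases Int.units_eq_one_or x.2 with hs | hs
  · simp only [hs, Units.val_one, if_true] at h1 h2; nlinarith
  · simp only [hs, Units.val_neg, Units.val_one, show (-1 : ℤ) ≠ 1 by norm_num, if_false] at h1 h2; nlinarith

/-- For an aspect-`88` route inside the last subbox `Dcorr = c + {-2r ≤ σ x_a ≤ 22r, |x_j| ≤ 2r}`, the scale is at most `r`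
(`89ℓ ≤ 24r`). [cite: KozmaNitzan2024, §4 p. 25] -/
theorem scale_le_of_elongList_Qset_subset_Dcorr (S : CData d) {g : Geom d} (hg : g ∈ elongList d 88 (by norm_num)) {ℓ : ℕ}
    {v : Site d} (h : g.Qset ℓ v ⊆ S.Dcorr) : ℓ ≤ S.r := by
  obtain ⟨a, ha⟩ := succ_mul_scale_le_of_elongList_Qset_subset hg h
  have hwidth : sHi S.a S.σ S.c (-(2 * S.r : ℤ)) (22 * S.r) (2 * S.r) a - sLo S.a S.σ S.c (-(2 * S.r : ℤ)) (22 * S.r) (2 * S.r) a ≤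
      24 * S.r := by
    simp only [sLo, sHi]
    by_cases hj : a = S.a
    · rw [if_pos hj, if_pos hj]
      rcases S.hσ with h1 | h1
      · rw [if_pos h1, if_pos h1]; linarith
      · rw [if_neg (by rw [h1]; norm_num), if_neg (by rw [h1]; norm_num)]; linarith
    · rw [if_neg hj, if_neg hj]; linarith
  have : (89 : ℤ) * ℓ ≤ 24 * S.r := by push_cast at ha; linarith
  have : (ℓ : ℤ) ≤ S.r := by linarith
  exact_mod_cast this

/-! ## The halving steps, additive -/

/-- **One halving step, ADDITIVE** (KN p. 24; tree `halvingStep_of_target`): if the additive target lemma holds with loss `η` for the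
quarter-face geometries, radius `R₀` and route scales up to `ℓhi ≥ 5r`, then for every cell datum `S` (hypotheses `S.Hyp p`), in the
weighting restricted to `A`: `P(o ↔ B_k) − η ≤ P(o ↔ B_{k+1})` (`k < d`, `R₀ ≤ R`, `R₀ ≤ ℓ_h`, `⌈r/2⌉ + kR + R ≤ r`).
The target `B_{k+1}` of `B_k⟨R⟩` inside the near cube is the tree's `isTarget_halving`; its routes have scale `ℓ_h ≤ 5r`.
[cite: KozmaNitzan2024, §4 p. 24] -/
theorem halvingStep_additive [NeZero d] (p : unitInterval) {η : ℝ} {R₀ ℓhi : ℕ}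
    (hT : ∀ (W : Sym2 (Site d) → unitInterval) (Sfin D : Finset (Site d)) (lo hi : Site d) (T : Finset (Site d)) (o : Site d),
      FinSupp W Sfin → IsSubbox W p D → D ⊆ Sfin → o ∈ Sfin → o ∉ D →
      Finset.Icc (lo - (R₀ : Site d)) (hi + (R₀ : Site d)) ⊆ D →
      (∀ v ∈ Finset.Icc (lo - (R₀ : Site d)) (hi + (R₀ : Site d)), ∃ ℓ : ℕ, R₀ ≤ ℓ ∧ ℓ ≤ ℓhi ∧
        ∃ g ∈ qfList d, g.Qset ℓ v ⊆ D ∧ g.Fset ℓ v ⊆ T) →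
      T ⊆ D → T.Nonempty →
      (prodBernoulli W).real (⋃ b ∈ Finset.Icc lo hi, openConn o b) - η ≤ (prodBernoulli W).real (⋃ t ∈ T, openConn o t))
    (S : CData d) (hS : S.Hyp p) (k R : ℕ) (hk : k < d) (hR : R₀ ≤ R) (hRlh : R₀ ≤ S.lh)
    (hfit : ((S.r + 1) / 2 : ℕ) + (k : ℤ) * R + R ≤ S.r) (hℓhi : 5 * S.r ≤ ℓhi) :
    (prodBernoulli (restrW (↑S.Aset : Set (Site d)) S.W)).real (⋃ b ∈ S.Bk k R, openConn S.o b) - η ≤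
      (prodBernoulli (restrW (↑S.Aset : Set (Site d)) S.W)).real (⋃ b ∈ S.Bk (k + 1) R, openConn S.o b) := by
  have hR' : (R₀ : ℤ) ≤ R := by exact_mod_cast hR
  have hfit0 : ((S.r + 1) / 2 : ℕ) + (k : ℤ) * R + R₀ ≤ S.r := by linarith
  have hkR : (k : ℤ) * R + R₀ ≤ 2 * S.r := by
    have : (0 : ℤ) ≤ ((S.r + 1) / 2 : ℕ) := by positivity
    linarith
  have hkR1 : ((k + 1 : ℕ) : ℤ) * R ≤ 2 * S.r := by push_cast; linarith
  have htgt := S.isTarget_halving hk hR hRlh hfit0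
  refine hT (restrW (↑S.Aset : Set (Site d)) S.W) S.Aset S.nearQ (S.c - S.hwid k R) (S.c + S.hwid k R)
    (S.Bk (k + 1) R) S.o (finSupp_restrW S.Aset S.W)
    ((CData.isSubbox_nearQ hS).restrW (Finset.coe_subset.2 (CData.nearQ_subset_Aset hS)))
    (CData.nearQ_subset_Aset hS) (CData.o_mem_Aset hS) (CData.o_not_mem_nearQ hS) (S.enlarge_Bk_subset_nearQ hkR)
    (fun v hv => ?_) (S.Bk_subset_nearQ hkR1) (S.Bk_nonempty _ _)
  obtain ⟨ℓ, hℓ, g, hg, hQ, hF⟩ := htgt.hit v hv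
  exact ⟨ℓ, hℓ, (scale_le_of_qfList_Qset_subset_nearQ S hg hQ).trans hℓhi, g, hg, hQ, hF⟩

/-- **The chain of `n` halving steps, ADDITIVE** (KN p. 24 "we continue this way, each time halving one dimension"; tree
`halvingChain_of_target`): `P(o ↔ B_k) − n·η ≤ P(o ↔ B_{k+n})` in the weighting restricted to `A`, for `k + n ≤ d`. [cite: KozmaNitzan2024, §4 p. 24] -/
theorem halvingChain_additive [NeZero d] (p : unitInterval) {η : ℝ} {R₀ ℓhi : ℕ}
    (hT : ∀ (W : Sym2 (Site d) → unitInterval) (Sfin D : Finset (Site d)) (lo hi : Site d) (T : Finset (Site d)) (o : Site d),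
      FinSupp W Sfin → IsSubbox W p D → D ⊆ Sfin → o ∈ Sfin → o ∉ D →
      Finset.Icc (lo - (R₀ : Site d)) (hi + (R₀ : Site d)) ⊆ D →
      (∀ v ∈ Finset.Icc (lo - (R₀ : Site d)) (hi + (R₀ : Site d)), ∃ ℓ : ℕ, R₀ ≤ ℓ ∧ ℓ ≤ ℓhi ∧
        ∃ g ∈ qfList d, g.Qset ℓ v ⊆ D ∧ g.Fset ℓ v ⊆ T) →
      T ⊆ D → T.Nonempty →
      (prodBernoulli W).real (⋃ b ∈ Finset.Icc lo hi, openConn o b) - η ≤ (prodBernoulli W).real (⋃ t ∈ T, openConn o t))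
    (S : CData d) (hS : S.Hyp p) (n k R : ℕ) (hkn : k + n ≤ d) (hR : R₀ ≤ R) (hRlh : R₀ ≤ S.lh)
    (hfit : ((S.r + 1) / 2 : ℕ) + (d : ℤ) * R + R ≤ S.r) (hℓhi : 5 * S.r ≤ ℓhi) :
    (prodBernoulli (restrW (↑S.Aset : Set (Site d)) S.W)).real (⋃ b ∈ S.Bk k R, openConn S.o b) - n * η ≤
      (prodBernoulli (restrW (↑S.Aset : Set (Site d)) S.W)).real (⋃ b ∈ S.Bk (k + n) R, openConn S.o b) := by
  induction n generalizing k with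
  | zero => simp
  | succ n ih =>
    have hfitk : ((S.r + 1) / 2 : ℕ) + (k : ℤ) * R + R ≤ S.r := by
      have : (k : ℤ) * R ≤ (d : ℤ) * R :=
        mul_le_mul_of_nonneg_right (by exact_mod_cast (by omega : k ≤ d)) (by positivity)
      linarith
    have step := halvingStep_additive p hT S hS k R (by omega) hR hRlh hfitk hℓhi
    have rest := ih (k + 1) (by omega)
    have e : k + 1 + n = k + (n + 1) := by ring
    rw [e] at rest
    push_cast
    linarith

/-! ## The corridor step, additive -/

/-- **The corridor step, ADDITIVE** (KN pp. 24–25; tree `corridorStep_of_target`): if the additive target lemma holds with loss `η` for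
the aspect-`88` elongated geometries, radius `R₀` and route scales up to `ℓhi ≥ r`, then in the weighting restricted to `U`:
`P(o ↔ B_d) − η ≤ P(o ↔ cnext + [-2r,2r]^d)` (`r ≥ 44`, `5R₀ + 5 ≤ r`, `4(ℓ_h + dR + R₀) + 4 ≤ 7r`). The target is the tree's `isTarget_corridor`;
its routes have scale `≤ r`. [cite: KozmaNitzan2024, §4 pp. 24–25] -/
theorem corridorStep_additive [NeZero d] (p : unitInterval) {η : ℝ} {R₀ ℓhi : ℕ}
    (hT : ∀ (W : Sym2 (Site d) → unitInterval) (Sfin D : Finset (Site d)) (lo hi : Site d) (T : Finset (Site d)) (o : Site d),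
      FinSupp W Sfin → IsSubbox W p D → D ⊆ Sfin → o ∈ Sfin → o ∉ D →
      Finset.Icc (lo - (R₀ : Site d)) (hi + (R₀ : Site d)) ⊆ D →
      (∀ v ∈ Finset.Icc (lo - (R₀ : Site d)) (hi + (R₀ : Site d)), ∃ ℓ : ℕ, R₀ ≤ ℓ ∧ ℓ ≤ ℓhi ∧
        ∃ g ∈ elongList d 88 (by norm_num), g.Qset ℓ v ⊆ D ∧ g.Fset ℓ v ⊆ T) →
      T ⊆ D → T.Nonempty →
      (prodBernoulli W).real (⋃ b ∈ Finset.Icc lo hi, openConn o b) - η ≤ (prodBernoulli W).real (⋃ t ∈ T, openConn o t))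
    (S : CData d) (hS : S.Hyp p) (R : ℕ) (h44 : 44 ≤ S.r) (hRc : 5 * R₀ + 5 ≤ S.r)
    (hΔ : 4 * ((S.lh : ℤ) + d * R + R₀) + 4 ≤ 7 * S.r) (hℓhi : S.r ≤ ℓhi) :
    (prodBernoulli (restrW (↑S.Uset : Set (Site d)) S.W)).real (⋃ b ∈ S.Bk d R, openConn S.o b) - η ≤
      (prodBernoulli (restrW (↑S.Uset : Set (Site d)) S.W)).real (⋃ b ∈ S.Tn (2 * S.r), openConn S.o b) := by
  -- `B_d⟨R₀⟩ ⊆ Dcorr` and `Tn (2r) ⊆ Dcorr` (as in the tree proof)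
  have hw : ∀ i, S.hwid d R i = S.lh + d * R := fun i => by rw [S.hwid_apply, if_pos i.2]
  have hRc' : 5 * (R₀ : ℤ) + 5 ≤ S.r := by exact_mod_cast hRc
  have hencl : Finset.Icc (S.c - S.hwid d R - (R₀ : Site d)) (S.c + S.hwid d R + (R₀ : Site d)) ⊆ S.Dcorr := by
    intro x hx
    rw [mem_Icc_iff] at hx
    simp only [Pi.sub_apply, Pi.add_apply, Pi.natCast_apply] at hx
    rw [S.mem_Dcorr_iff]
    have hlh : (0 : ℤ) ≤ S.lh := by positivity
    refine ⟨?_, fun j hj => ?_⟩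
    · have := hx S.a; rw [hw] at this
      have hb := level_bounds_of_abs_le S.hσ (x := S.c S.a) (y := x S.a) (ℓ := S.lh + d * R + R₀)
        (by linarith) (by linarith)
      have e : S.σ * (x S.a - S.c S.a) = S.σ * x S.a - S.σ * S.c S.a := by ring
      rw [e]; constructor <;> linarith [hb.1, hb.2]
    · have := hx j; rw [hw] at this
      constructor <;> linarith [this.1, this.2]
  have hTD : S.Tn (2 * S.r) ⊆ S.Dcorr := by
    intro x hx
    rw [S.mem_Tn_iff] at hx
    rw [S.mem_Dcorr_iff]
    push_cast at hx
    refine ⟨⟨by linarith [hx.1.1], by linarith [hx.1.2]⟩, fun j hj => ?_⟩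
    have := hx.2 j hj
    constructor <;> linarith [this.1, this.2]
  have htgt := S.isTarget_corridor (R := R) h44 hRc hΔ
  refine hT (restrW (↑S.Uset : Set (Site d)) S.W) S.Uset S.Dcorr (S.c - S.hwid d R) (S.c + S.hwid d R)
    (S.Tn (2 * S.r)) S.o (finSupp_restrW S.Uset S.W)
    ((CData.isSubbox_Dcorr hS).restrW (Finset.coe_subset.2 (CData.Dcorr_subset_Uset hS)))
    (CData.Dcorr_subset_Uset hS) (Finset.mem_union_left _ (CData.o_mem_Aset hS)) (CData.o_not_mem_Dcorr hS) hencl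
    (fun v hv => ?_) hTD (S.Tn_nonempty _)
  obtain ⟨ℓ, hℓ, g, hg, hQ, hF⟩ := htgt.hit v hv
  exact ⟨ℓ, hℓ, (scale_le_of_elongList_Qset_subset_Dcorr S hg hQ).trans hℓhi, g, hg, hQ, hF⟩

/-! ## Lemma 12, additive -/

/-- **Kozma–Nitzan's Lemma 12 with ADDITIVE losses** (tree `corridorLemma_of_target` :1573-1637, re-threaded).  Let the additive target
lemma hold at radius `R` with route scales up to `ℓhi ≥ 5r`, with loss `η_q` for the quarter-face geometries and loss `η_e` for the aspect-88
elongated geometries.  Then for every cell datum `S` of scale `r ≥ 100(d+1)(R+1)` satisfying `S.Hyp p`: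
`P_W(o ↔ c + [-3r,3r]^d in A) − (d·η_q + η_e) ≤ P_W(o ↔ cnext + [-3r,3r]^d in U)`.
Proof: into the weighting restricted to `A` (`prodBernoulli_restrW_real_biUnion_openConn`), `d` halving steps (`halvingChain_additive`), from
`A` to `U` by monotonicity, the corridor step (`corridorStep_additive`), back to `W` and the larger cube. [cite: KozmaNitzan2024, §4 Lemma 12 (pp. 23–25)] -/
theorem corridor_additive [NeZero d] (p : unitInterval) {ηq ηe : ℝ} {R ℓhi : ℕ}
    (hTq : ∀ (W : Sym2 (Site d) → unitInterval) (Sfin D : Finset (Site d)) (lo hi : Site d) (T : Finset (Site d)) (o : Site d),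
      FinSupp W Sfin → IsSubbox W p D → D ⊆ Sfin → o ∈ Sfin → o ∉ D →
      Finset.Icc (lo - (R : Site d)) (hi + (R : Site d)) ⊆ D →
      (∀ v ∈ Finset.Icc (lo - (R : Site d)) (hi + (R : Site d)), ∃ ℓ : ℕ, R ≤ ℓ ∧ ℓ ≤ ℓhi ∧
        ∃ g ∈ qfList d, g.Qset ℓ v ⊆ D ∧ g.Fset ℓ v ⊆ T) →
      T ⊆ D → T.Nonempty →
      (prodBernoulli W).real (⋃ b ∈ Finset.Icc lo hi, openConn o b) - ηq ≤ (prodBernoulli W).real (⋃ t ∈ T, openConn o t))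
    (hTe : ∀ (W : Sym2 (Site d) → unitInterval) (Sfin D : Finset (Site d)) (lo hi : Site d) (T : Finset (Site d)) (o : Site d),
      FinSupp W Sfin → IsSubbox W p D → D ⊆ Sfin → o ∈ Sfin → o ∉ D →
      Finset.Icc (lo - (R : Site d)) (hi + (R : Site d)) ⊆ D →
      (∀ v ∈ Finset.Icc (lo - (R : Site d)) (hi + (R : Site d)), ∃ ℓ : ℕ, R ≤ ℓ ∧ ℓ ≤ ℓhi ∧
        ∃ g ∈ elongList d 88 (by norm_num), g.Qset ℓ v ⊆ D ∧ g.Fset ℓ v ⊆ T) →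
      T ⊆ D → T.Nonempty →
      (prodBernoulli W).real (⋃ b ∈ Finset.Icc lo hi, openConn o b) - ηe ≤ (prodBernoulli W).real (⋃ t ∈ T, openConn o t))
    (S : CData d) (hS : S.Hyp p) (hm : 100 * (d + 1) * (R + 1) ≤ S.r) (hℓhi : 5 * S.r ≤ ℓhi) :
    (prodBernoulli S.W).real
        (⋃ b ∈ Finset.Icc (S.c - ((3 * S.r : ℕ) : Site d)) (S.c + ((3 * S.r : ℕ) : Site d)),
          openConnIn (↑S.Aset : Set (Site d)) S.o b) - (d * ηq + ηe) ≤
      (prodBernoulli S.W).real (⋃ b ∈ S.Tn (3 * S.r), openConnIn (↑S.Uset : Set (Site d)) S.o b) := by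
  -- arithmetic (as in the tree proof)
  have hm' : 100 * ((d : ℤ) + 1) * (R + 1) ≤ S.r := by exact_mod_cast hm
  have hd0 : (0 : ℤ) ≤ d := by positivity
  have hR0 : (0 : ℤ) ≤ R := by positivity
  have hdR : (0 : ℤ) ≤ d * R := by positivity
  have hexp : 100 * ((d : ℤ) + 1) * (R + 1) = 100 * (d * R) + 100 * d + 100 * R + 100 := by ring
  have hlh := S.two_lh
  have hhalf' : (((S.r + 1) / 2 : ℕ) : ℤ) + (S.r : ℤ) = S.lh := by unfold CData.lh; push_cast; ring
  -- into the restricted weighting on `A`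
  have ho : S.o ∈ (↑S.Aset : Set (Site d)) := Finset.mem_coe.2 (CData.o_mem_Aset hS)
  have hA : (prodBernoulli (restrW (↑S.Aset : Set (Site d)) S.W)).real (⋃ b ∈ S.Bk 0 R, openConn S.o b) =
      (prodBernoulli S.W).real
        (⋃ b ∈ Finset.Icc (S.c - ((3 * S.r : ℕ) : Site d)) (S.c + ((3 * S.r : ℕ) : Site d)),
          openConnIn (↑S.Aset : Set (Site d)) S.o b) := by
    rw [S.Bk_zero, ← Finset.set_biUnion_coe, prodBernoulli_restrW_real_biUnion_openConn S.W _ ho,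
      Finset.set_biUnion_coe]
  -- the halving chain: `d` steps from `B_0` to `B_d`
  have h1 := halvingChain_additive p hTq S hS d 0 R (by omega) le_rfl ?_ ?_ hℓhi
  rotate_left
  · have : (R : ℤ) ≤ S.lh := by linarith
    exact_mod_cast this
  · have hdRh : (d : ℤ) * R ≤ d * R := le_rfl
    linarith
  rw [zero_add] at h1
  -- from `A` to `U`
  have hoU : S.o ∈ (↑S.Uset : Set (Site d)) := Finset.mem_coe.2 (CData.Aset_subset_Uset (CData.o_mem_Aset hS))
  have h2 : (prodBernoulli (restrW (↑S.Aset : Set (Site d)) S.W)).real (⋃ b ∈ S.Bk d R, openConn S.o b) ≤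
      (prodBernoulli (restrW (↑S.Uset : Set (Site d)) S.W)).real (⋃ b ∈ S.Bk d R, openConn S.o b) := by
    rw [← Finset.set_biUnion_coe, prodBernoulli_restrW_real_biUnion_openConn S.W _ hoU,
      prodBernoulli_restrW_real_biUnion_openConn S.W _ ho]
    exact measureReal_mono (biUnion_openConnIn_mono (Finset.coe_subset.2 CData.Aset_subset_Uset) S.o subset_rfl)
      (measure_ne_top _ _)
  -- the corridor step
  have h3 := corridorStep_additive p hTe S hS R ?_ ?_ ?_ (by linarith : S.r ≤ ℓhi)
  rotate_left
  · have : (44 : ℤ) ≤ S.r := by linarith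
    exact_mod_cast this
  · have : 5 * (R : ℤ) + 5 ≤ S.r := by linarith
    exact_mod_cast this
  · nlinarith
  -- back to `W`, and the larger target cube
  have h4 : (prodBernoulli (restrW (↑S.Uset : Set (Site d)) S.W)).real (⋃ b ∈ S.Tn (2 * S.r), openConn S.o b) ≤
      (prodBernoulli S.W).real (⋃ b ∈ S.Tn (3 * S.r), openConnIn (↑S.Uset : Set (Site d)) S.o b) := by
    rw [← Finset.set_biUnion_coe, prodBernoulli_restrW_real_biUnion_openConn S.W _ hoU]
    rw [← Finset.set_biUnion_coe]
    refine measureReal_mono (biUnion_openConnIn_mono subset_rfl S.o (Finset.coe_subset.2 ?_)) (measure_ne_top _ _)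
    intro x hx
    rw [S.mem_Tn_iff] at hx ⊢
    push_cast at hx ⊢
    refine ⟨⟨by linarith [hx.1.1], by linarith [hx.1.2]⟩, fun j hj => ?_⟩
    have := hx.2 j hj
    constructor <;> linarith [this.1, this.2]
  rw [← hA]
  linarith

/-- **Lemma 12, additive ⇒ threshold form** — binder-for-binder the corridor hypothesis `hcorr` of
`Quant.ksch_theta_slab_pos_of_finiteSizeAt` (`…QuantSlabPercOfFiniteSize.lean`), at cell scale `r₀ ≥ 100(d+1)(R+1)`, input tolerance `δc`
and output tolerance `ε'`, valid as soon as `δc + d·η_q + η_e ≤ ε'`. [cite: KozmaNitzan2024, §4 Lemma 12 (pp. 23–25), Theorem 6 (p. 26 (33))] -/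
theorem corridor_threshold [NeZero d] (p : unitInterval) {ηq ηe δc ε' : ℝ} {R ℓhi r₀ : ℕ}
    (hTq : ∀ (W : Sym2 (Site d) → unitInterval) (Sfin D : Finset (Site d)) (lo hi : Site d) (T : Finset (Site d)) (o : Site d),
      FinSupp W Sfin → IsSubbox W p D → D ⊆ Sfin → o ∈ Sfin → o ∉ D →
      Finset.Icc (lo - (R : Site d)) (hi + (R : Site d)) ⊆ D →
      (∀ v ∈ Finset.Icc (lo - (R : Site d)) (hi + (R : Site d)), ∃ ℓ : ℕ, R ≤ ℓ ∧ ℓ ≤ ℓhi ∧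
        ∃ g ∈ qfList d, g.Qset ℓ v ⊆ D ∧ g.Fset ℓ v ⊆ T) →
      T ⊆ D → T.Nonempty →
      (prodBernoulli W).real (⋃ b ∈ Finset.Icc lo hi, openConn o b) - ηq ≤ (prodBernoulli W).real (⋃ t ∈ T, openConn o t))
    (hTe : ∀ (W : Sym2 (Site d) → unitInterval) (Sfin D : Finset (Site d)) (lo hi : Site d) (T : Finset (Site d)) (o : Site d),
      FinSupp W Sfin → IsSubbox W p D → D ⊆ Sfin → o ∈ Sfin → o ∉ D →
      Finset.Icc (lo - (R : Site d)) (hi + (R : Site d)) ⊆ D →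
      (∀ v ∈ Finset.Icc (lo - (R : Site d)) (hi + (R : Site d)), ∃ ℓ : ℕ, R ≤ ℓ ∧ ℓ ≤ ℓhi ∧
        ∃ g ∈ elongList d 88 (by norm_num), g.Qset ℓ v ⊆ D ∧ g.Fset ℓ v ⊆ T) →
      T ⊆ D → T.Nonempty →
      (prodBernoulli W).real (⋃ b ∈ Finset.Icc lo hi, openConn o b) - ηe ≤ (prodBernoulli W).real (⋃ t ∈ T, openConn o t))
    (hm : 100 * (d + 1) * (R + 1) ≤ r₀) (hℓhi : 5 * r₀ ≤ ℓhi) (htol : δc + (d * ηq + ηe) ≤ ε') :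
    ∀ T : CData d, T.Hyp p → T.r = r₀ →
      1 - δc < (prodBernoulli T.W).real
          (⋃ b ∈ Finset.Icc (T.c - ((3 * T.r : ℕ) : Site d)) (T.c + ((3 * T.r : ℕ) : Site d)),
            openConnIn (↑T.Aset : Set (Site d)) T.o b) →
        1 - ε' < (prodBernoulli T.W).real (⋃ b ∈ T.Tn (3 * T.r), openConnIn (↑T.Uset : Set (Site d)) T.o b) := by
  intro S hS hr hin
  have h := corridor_additive p hTq hTe S hS (by rw [hr]; exact hm) (by rw [hr]; exact hℓhi)
  linarith

/-- **Lemma 12 EFFECTIVE**: the losses of `corridor_additive` discharged by the additive target lemma `Quant.targetLemma_additive_core`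
(seat `prim-quant-p2`), `η_q = η_e = 6δ`.  Hypotheses, all finite-volume at parameter `p` (`0 ≤ p < 1`): (a) every quarter-face geometry and
every aspect-88 elongated geometry is hit from `Λ_m` inside `ℓQ` with probability `> 1 − δ²` at every scale `ℓ ∈ [ℓmax, ℓhi]`, `ℓhi ≥ 5r`;
(b) `Λ_m` is joined to every orthant face of `Λ_M` inside `Λ_M` with probability `> 1 − δ²`; (c) `P_p(uniqZone m M) > 1 − δ²`;
(d) `(1 − p^{seedBound d M})^k ≤ δ`; (e) `R ≥ 3M + ℓmax + 4 + ⌈(1−p)^{−2d·Ncont d M k}/δ⌉`.  Conclusion: for every cell datum of scale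
`r ≥ 100(d+1)(R+1)`, `P_W(o ↔ c+[-3r,3r]^d in A) − 6(d+1)δ ≤ P_W(o ↔ cnext+[-3r,3r]^d in U)`.  No `θ(p) > 0`, no `IsHittable`, no `TargetProperty`.
[cite: KozmaNitzan2024, §4 Lemma 12 (pp. 23–25), Lemma 10 (pp. 17–22)] -/
theorem corridor_effective [NeZero d] (p : unitInterval) (hp1 : (p : ℝ) < 1)
    {δ : ℝ} (hδ : 0 < δ) {m M ℓmax ℓhi k R : ℕ} (hmM : m < M)
    (hhitq : ∀ g ∈ qfList d, ∀ ℓ : ℕ, ℓmax ≤ ℓ → ℓ ≤ ℓhi →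
      1 - δ ^ 2 < (bondPercolation (zdGraph d) p).real (linkIn (↑(g.Qset ℓ 0)) (box d m) (g.Fset ℓ 0)))
    (hhite : ∀ g ∈ elongList d 88 (by norm_num), ∀ ℓ : ℕ, ℓmax ≤ ℓ → ℓ ≤ ℓhi →
      1 - δ ^ 2 < (bondPercolation (zdGraph d) p).real (linkIn (↑(g.Qset ℓ 0)) (box d m) (g.Fset ℓ 0)))
    (hface : ∀ (a : Fin d) (τ : Fin d → ℤˣ),
      1 - δ ^ 2 < (bondPercolation (zdGraph d) p).real (linkEvent (box d m) (orthantFace a τ M) M))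
    (huniq : 1 - δ ^ 2 < (bondPercolation (zdGraph d) p).real (uniqZone m M))
    (hk : (1 - (p : ℝ) ^ seedBound d M) ^ k ≤ δ)
    (hR : 3 * M + ℓmax + 4 + ⌈(1 / (1 - (p : ℝ)) ^ (2 * d * LData.Ncont d M k)) / δ⌉₊ ≤ R)
    (S : CData d) (hS : S.Hyp p) (hm : 100 * (d + 1) * (R + 1) ≤ S.r) (hℓhi : 5 * S.r ≤ ℓhi) :
    (prodBernoulli S.W).real
        (⋃ b ∈ Finset.Icc (S.c - ((3 * S.r : ℕ) : Site d)) (S.c + ((3 * S.r : ℕ) : Site d)),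
          openConnIn (↑S.Aset : Set (Site d)) S.o b) - 6 * (d + 1) * δ ≤
      (prodBernoulli S.W).real (⋃ b ∈ S.Tn (3 * S.r), openConnIn (↑S.Uset : Set (Site d)) S.o b) := by
  have hq := targetLemma_additive_core p hp1 hδ (qfList d) hmM hhitq hface huniq hk hR
  have he := targetLemma_additive_core p hp1 hδ (elongList d 88 (by norm_num)) hmM hhite hface huniq hk hR
  have h := corridor_additive p (ηq := 6 * δ) (ηe := 6 * δ) (R := R) (ℓhi := ℓhi)
    (fun W Sfin D lo hi T o hfin hsub hDS ho hoD hBR htgt hTD hTne =>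
      hq W Sfin D lo hi T o hfin hsub hDS ho hoD hBR htgt hTD hTne)
    (fun W Sfin D lo hi T o hfin hsub hDS ho hoD hBR htgt hTD hTne =>
      he W Sfin D lo hi T o hfin hsub hDS ho hoD hBR htgt hTD hTne)
    S hS hm hℓhi
  have e : (d : ℝ) * (6 * δ) + 6 * δ = 6 * (d + 1) * δ := by ring
  rw [e] at h
  exact h

end Summit.CriticalPhenomena.PercolationContinuityZ3.Theorems.Quant

end
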